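import Summits.AnomalousDissipation.AnomalousDissipation.Theses.TwoAndHalfD
import Literature.Analysis.FluidPDE.TwoHalfNavierStokes
import Literature.Analysis.FluidPDE.TwoHalfSection
import Literature.Analysis.FluidPDE.LongTimeAverageNonneg
import Literature.Analysis.FluidPDE.PassiveScalarEnergyL1Sobolev
import Summits.AnomalousDissipation.AnomalousDissipation.Theorems.TwoAndHalfDTwohalfdNegPlanarNoAnomaly
import Summits.AnomalousDissipation.AnomalousDissipation.Theorems.TwoAndHalfDTwohalfdNegReductionOffZero
import Summits.AnomalousDissipation.AnomalousDissipation.Theorems.TwoAndHalfDTwohalfdNegQuietOfSubLog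
import Summits.AnomalousDissipation.AnomalousDissipation.Theorems.TwoAndHalfDTwohalfdNegAgeDecouplingGrid

/-!
# The purely planar-force sub-case of the crux `TwoAndHalfD.TwohalfdNeg`
# (stmt-AnomalousDissipation-0211): no source, no scalar anomaly, no restriction on `g`

A second unconditional sub-case of the crux on the line `log-kantorovich-enstrophy-transfer`
(sibling of `Certificate.twohalfdNeg_twoHalf_singleShell`): if the `x₃`-invariant steady force is
PURELY PLANAR, `f = twoHalf g 0 = (g, 0) ∘ π` with `g` ANY smooth divergence-free mean-zero planar
field (any number of shells), then every bounded-energy family of `x₃`-invariant global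
Leray–Hopf solutions of NS_{ν_j}(`f`), `ν_j → 0`, from arbitrary `L²` data has
`meanDissipation → 0`. The third component is then a FREE advected–diffused scalar, whose
releases (of the zero profile) dissipate nothing (`IsWeakScalarTransportOn.energy_ineq…`:
`2·D ≤ ‖0‖² = 0`), so the quiet hypothesis of the grid age-decoupling stub S3' holds trivially
and S3' kills the scalar half WITHOUT the sub-log strain law S6; the planar half is S2
(Alexakis–Doering). This is the paper sub-case (iv) of the disprover's work file
(`Cruxes/TwohalfdNeg/Disproof.lean`, cycle 2), now a theorem; together with the single-shell
sub-case it shows that a counterexample to the crux needs BOTH a planar force on ≥ 2 shells AND a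
non-zero source. The file closes with the registered tools stub `stub_zeroSourceCertificate`.
Supports stmt-AnomalousDissipation-0211.
-/

namespace Summit.AnomalousDissipation.AnomalousDissipation.Theorems.TwohalfdNeg.ZeroSource

open MeasureTheory Filter Topology Set
open scoped ENNReal NNReal
open Literature.Analysis.FunctionSpaces Literature.Analysis.FluidPDE
open Summit.AnomalousDissipation.AnomalousDissipation.Theorems.TwohalfdNeg

set_option linter.dupNamespace false

/-- **Releases of the zero profile are quiet.** For a global Leray–Hopf drift `v` on `T²`,
`κ > 0`, `0 < S`, `0 ≤ s` and ANY weak solution `ϑ` of `∂_τϑ + v(s+τ)·∇ϑ = κΔϑ`, `ϑ(0) = 0`,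
on `[0, S+1)`: `eScalarDissipation κ ϑ 0 S = 0` (DiPerna–Lions energy inequality over an
`L¹ₜḢ¹ₓ` drift, `2·D(0,S+1) ≤ ‖0‖₂² = 0`, and monotonicity of the window). [folklore] -/
theorem eScalarDissipation_release_zero_eq_zero {ν κ S s : ℝ}
    {g v₀ : UnitAddTorus (Fin 2) → EuclideanSpace ℝ (Fin 2)}
    {v : ℝ → UnitAddTorus (Fin 2) → EuclideanSpace ℝ (Fin 2)}
    (hv : Torus.IsGlobalLerayHopf ν (fun _ => g) v₀ v) (hκ : 0 < κ) (hS : 0 < S) (hs : 0 ≤ s)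
    {ϑ : ℝ → UnitAddTorus (Fin 2) → ℝ}
    (hϑ : Torus.IsWeakScalarTransportOn (S + 1) κ (fun τ => v (s + τ)) 0 ϑ) :
    Torus.eScalarDissipation κ ϑ 0 S = 0 := by
  have hG := QuietOfSubLog.lintegral_window_rpow_half_lt_top hv hs (by linarith : 0 < S + 1)
  have hE := Torus.IsWeakScalarTransportOn.energy_ineq_of_lintegral_eGradNormSq_rpow_lt_top hκ hϑ
    (MemLp.zero' (p := 2) (μ := volume)) hG
  have h0 : (∫⁻ x : UnitAddTorus (Fin 2), ‖(0 : UnitAddTorus (Fin 2) → ℝ) x‖ₑ ^ 2) = 0 := by simp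
  rw [h0, nonpos_iff_eq_zero, mul_eq_zero] at hE
  have hD : Torus.eScalarDissipation κ ϑ 0 (S + 1) = 0 := by
    rcases hE with h | h
    · exact absurd h two_ne_zero
    · exact h
  refine le_antisymm ?_ bot_le
  rw [← hD]
  unfold Torus.eScalarDissipation
  exact mul_le_mul' le_rfl (lintegral_mono_set (Ioo_subset_Ioo le_rfl (by linarith)))

/-- **The purely planar-force sub-case of the crux (unconditional).** For ANY smooth
divergence-free mean-zero planar field `g` on `T²` and the `x₃`-invariant steady force
`f = twoHalf g 0 = (g, 0) ∘ π` (no vertical component), every family of `x₃`-invariant global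
Leray–Hopf solutions of NS_{ν_j} on `T³` forced by `f`, with `ν_j → 0`, arbitrary `L²` data and
`ν`-uniformly bounded `limsup`-mean energy, has `meanDissipation (ν j) (u j) → 0`. Proof: split
with S1' (`ReductionOffZero`; the returned planar force is `g`, the returned source is `0`); the
planar half is S2 (`PlanarNoAnomaly`); the scalar half is S3' (`AgeDecouplingGrid`) whose quiet
hypothesis holds trivially because releases of the zero profile have zero dissipation
(`eScalarDissipation_release_zero_eq_zero`); squeeze. [folklore] -/
theorem twohalfdNeg_twoHalf_zeroSource :
    ∀ g : UnitAddTorus (Fin 2) → EuclideanSpace ℝ (Fin 2),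
      Torus.IsSmooth g → Torus.IsDivFree g → Torus.HasZeroMean g →
      ∀ (ν : ℕ → ℝ) (u₀ : ℕ → UnitAddTorus (Fin 3) → EuclideanSpace ℝ (Fin 3))
        (u : ℕ → ℝ → UnitAddTorus (Fin 3) → EuclideanSpace ℝ (Fin 3)),
        (∀ j, 0 < ν j) → Tendsto ν atTop (𝓝 0) →
        (∀ j, Torus.IsGlobalLerayHopf (ν j) (fun _ => Torus.twoHalf g 0) (u₀ j) (u j)) →
        (∀ j (t : ℝ) (s : UnitAddCircle) (x : UnitAddTorus (Fin 3)),
          u j t (x + Pi.single (2 : Fin 3) s) = u j t x) →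
        (∃ E : ℝ, ∀ j, meanEnergy (u j) ≤ E) →
        Tendsto (fun j => meanDissipation (ν j) (u j)) atTop (𝓝 0) := by
  intro g hgs hgd hgz ν u₀ u hν hν0 hLH huinv hE
  have hhs : Torus.IsSmooth (0 : UnitAddTorus (Fin 2) → ℝ) := Torus.isSmooth_const (0 : ℝ)
  have hhz : Torus.HasZeroMean (0 : UnitAddTorus (Fin 2) → ℝ) := by
    show ∫ x, (0 : UnitAddTorus (Fin 2) → ℝ) x = 0
    simp
  have hfinv : ∀ (s : UnitAddCircle) (x : UnitAddTorus (Fin 3)),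
      Torus.twoHalf g 0 (x + Pi.single (2 : Fin 3) s) = Torus.twoHalf g 0 x := by
    intro s x
    rw [Torus.twoHalf_eq_comp, Function.comp_apply, Function.comp_apply]
    exact Torus.comp_planarProj_add_single (fun y => Torus.planarEmbed (g y, (0 : UnitAddTorus (Fin 2) → ℝ) y)) s x
  have hfs : Torus.IsSmooth (Torus.twoHalf g 0) := hgs.twoHalf hhs
  have hfd : Torus.IsDivFree (Torus.twoHalf g 0) := Torus.IsDivFree.twoHalf hgd 0
  have hfz : Torus.HasZeroMean (Torus.twoHalf g 0) :=
    Torus.hasZeroMean_twoHalf hgs.continuous.integrable_unitAddTorus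
      hhs.continuous.integrable_unitAddTorus hgz hhz
  obtain ⟨g', h', v₀, v, θ₀, θ, hgs', hgd', hgz', hhs', hhz', hfeq, -, hvLH, hθ₀, hθw, hEv, hEθ, hsplit⟩ :=
    ReductionOffZero.stub_reductionOffZero (Torus.twoHalf g 0) hfinv hfs hfd hfz ν u₀ u hν hLH huinv hE
  obtain rfl : g = g' := Literature.Analysis.FluidPDE.Torus.twoHalf_left_injective hfeq
  obtain rfl : (0 : UnitAddTorus (Fin 2) → ℝ) = h' :=
    Literature.Analysis.FluidPDE.Torus.twoHalf_right_injective hfeq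
  have hplanar : Tendsto (fun j => meanDissipation (ν j) (v j)) atTop (𝓝 0) :=
    PlanarNoAnomaly.stub_planarNoAnomaly g hgs hgd hgz ν v₀ v hν hν0 hvLH hEv
  -- releases of the zero profile are quiet: the hypothesis of S3' holds trivially
  have hquiet : ∀ S δ : ℝ, 0 < S → 0 < δ → ∀ ϑ : ℕ → ℕ → ℝ → UnitAddTorus (Fin 2) → ℝ,
      (∀ (j n : ℕ), Torus.IsWeakScalarTransportOn (S + 1) (ν j)
          (fun τ => v j (δ * (n + 1) + τ)) 0 (ϑ j n)) →
      Tendsto (fun j => limsup (fun N : ℕ => (N : ℝ)⁻¹ *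
          ∑ n ∈ Finset.range N, (Torus.eScalarDissipation (ν j) (ϑ j n) 0 S).toReal) atTop)
        atTop (𝓝 0) := by
    intro S δ hS hδ ϑ hϑ
    have hzero : ∀ j n, Torus.eScalarDissipation (ν j) (ϑ j n) 0 S = 0 := fun j n =>
      eScalarDissipation_release_zero_eq_zero (hvLH j) (hν j) hS (by positivity) (hϑ j n)
    have hfun : (fun j => limsup (fun N : ℕ => (N : ℝ)⁻¹ *
        ∑ n ∈ Finset.range N, (Torus.eScalarDissipation (ν j) (ϑ j n) 0 S).toReal) atTop) =
        fun _ => 0 := by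
      funext j
      simp only [hzero, ENNReal.toReal_zero, Finset.sum_const_zero, mul_zero]
      exact limsup_const 0
    rw [hfun]
    exact tendsto_const_nhds
  have hscalar : Tendsto (fun j => longTimeAvgSup
      (fun t => ν j * (Torus.eScalarGradNormSq (θ j t)).toReal)) atTop (𝓝 0) :=
    AgeDecouplingGrid.stub_ageDecouplingGrid g 0 hgs hgd hgz hhs hhz ν v₀ v θ₀ θ hν hvLH hEv hθ₀ hθw
      hEθ hquiet
  have hsum : Tendsto (fun j => meanDissipation (ν j) (v j) +
      longTimeAvgSup (fun t => ν j * (Torus.eScalarGradNormSq (θ j t)).toReal)) atTop (𝓝 0) := by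
    simpa using hplanar.add hscalar
  exact squeeze_zero (fun j => meanDissipation_nonneg (hν j).le (u j)) hsplit hsum

/-- **Registered tools stub `stub_zeroSourceCertificate`** (registered on
stmt-AnomalousDissipation-0211 with `ledger workitem stub-add`): the purely planar-force sub-case
of the crux, verbatim `twohalfdNeg_twoHalf_zeroSource`. -/
theorem stub_zeroSourceCertificate :
    ∀ g : UnitAddTorus (Fin 2) → EuclideanSpace ℝ (Fin 2),
      Torus.IsSmooth g → Torus.IsDivFree g → Torus.HasZeroMean g →
      ∀ (ν : ℕ → ℝ) (u₀ : ℕ → UnitAddTorus (Fin 3) → EuclideanSpace ℝ (Fin 3))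
        (u : ℕ → ℝ → UnitAddTorus (Fin 3) → EuclideanSpace ℝ (Fin 3)),
        (∀ j, 0 < ν j) → Tendsto ν atTop (𝓝 0) →
        (∀ j, Torus.IsGlobalLerayHopf (ν j) (fun _ => Torus.twoHalf g 0) (u₀ j) (u j)) →
        (∀ j (t : ℝ) (s : UnitAddCircle) (x : UnitAddTorus (Fin 3)),
          u j t (x + Pi.single (2 : Fin 3) s) = u j t x) →
        (∃ E : ℝ, ∀ j, meanEnergy (u j) ≤ E) →
        Tendsto (fun j => meanDissipation (ν j) (u j)) atTop (𝓝 0) :=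
  twohalfdNeg_twoHalf_zeroSource

end Summit.AnomalousDissipation.AnomalousDissipation.Theorems.TwohalfdNeg.ZeroSource
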